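import Summits.SmoothPoincare4.SmoothPoincare4.Theses.EinsteinBulk
import Summits.SmoothPoincare4.SmoothPoincare4.Theses.InformationMetricHadamard
import Summits.SmoothPoincare4.SmoothPoincare4.Theorems.EinsteinBulkEinsteinHadamardFillingStandard

/-!
# Crux `PEFillNearRound` (stmt-SmoothPoincare4-7997): the route-level split `standard-or-gap`, its glue
# and its exactness

`PEFillNearRound ⇐ PEFillStandardSphere (item stmt-SmoothPoincare4-18033) ∧ YamabeNearRoundSpheresStandard
(item stmt-SmoothPoincare4-18032)` — the glue `peFillNearRoundOfPieces_proof` (pure logic, `δ := min δ₁ δ₂`),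
together with the EXACTNESS of the cut: `PEFillNearRound → PEFillStandardSphere` (restriction) and
`YamabePinchedEinsteinBulk (7996, Li–Qing–Shi) → PEFillNearRound → YamabeNearRoundSpheresStandard` through the
PROVED recogniser `EinsteinHadamardFillingStandard_proof` (7999): a PE-filled near-round class on a homotopy
4-sphere is pinched (`|K+1| ≤ 1/2`) hence non-positively curved, hence its carrier is standard. So, modulo the
published Li–Qing–Shi theorem, the crux is EQUIVALENT to the conjunction of its two pieces, and the SPC4 half
`YamabeNearRoundSpheresStandard` is sandwiched: `SmoothPoincare4 → it` and `it → YamabeExtremalSpheres (7998) →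
SmoothPoincare4` (both recorded below).

The glue and the two exactness theorems were written by the crux-strategist
`planner-cstrat-stmt-SmoothPoincare4-7997-r1-0` (`Cruxes/PEFillNearRound/Lines/route_split.lean`, 2026-08-17) and are
landed here verbatim by the line lead of 7997 (line `Sketch` = split standard-or-thin), who adds the glue for the
second route sharing the crux (`InformationMetricHadamard.PEFillNearRound`, same statement text), the SPC4 sandwich,
and the two registered logical helpers of the line: `helper_peFillNearRound_of_halves` (the registered stubs
`stub_peFillStandard` = 18033 verbatim and `stub_exoticYamabeGap` = the negative form of 18032 imply the crux) and
`helper_exoticYamabeGap_of_peFill` (the crux and Li–Qing–Shi imply the GAP stub).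
-/

noncomputable section

-- the prescribed namespace `Summit.<P>.<Sub>.…` duplicates `SmoothPoincare4` (P = Sub)
set_option linter.dupNamespace false

open scoped Manifold ContDiff Topology ContinuousMap
open Summit.SmoothPoincare4.SmoothPoincare4.Theses

namespace Summit.SmoothPoincare4.SmoothPoincare4.Theorems.PEFillNearRoundSplit

/-! ## The glue -/

/-- Monotonicity of the inlined Yamabe lower bound `(1 - δ)·C·√V ≤ I` in the slack parameter `δ`. -/
theorem yamabeBound_mono {δ δ' C V I : ℝ} (hδ : δ' ≤ δ) (hC : 0 ≤ C) (hV : 0 ≤ V)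
    (h : (1 - δ') * C * V ≤ I) : (1 - δ) * C * V ≤ I :=
  (mul_le_mul_of_nonneg_right (mul_le_mul_of_nonneg_right (sub_le_sub_left hδ 1) hC) hV).trans h

/-- **GLUE of the split: `PEFillStandardSphere → YamabeNearRoundSpheresStandard → PEFillNearRound`.**
Seam: `δ := min δ₁ δ₂`; for a homotopy 4-sphere `M` with a `δ`-near-round `g₀`, the second piece gives `M ≅ S⁴`,
then the first piece fills `(M, [g₀])` (crux-strategist r1, `route_split.lean`). -/
theorem peFillNearRoundOfPieces_proof :
    EinsteinBulk.PEFillStandardSphere → EinsteinBulk.YamabeNearRoundSpheresStandard → EinsteinBulk.PEFillNearRound := by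
  rintro ⟨δ₁, hδ₁, H1⟩ ⟨δ₂, hδ₂, H2⟩
  refine ⟨min δ₁ δ₂, lt_min hδ₁ hδ₂, ?_⟩
  intro M _ _ _ _ _ _ _ _ _ he g₀ hY
  have hstd : Nonempty (M ≃ₘ⟮𝓡 4, 𝓡 4⟯ Metric.sphere (0 : EuclideanSpace ℝ (Fin 5)) 1) :=
    H2 M he g₀ (fun h' _ hconf =>
      yamabeBound_mono (min_le_right _ _) (by positivity) (Real.sqrt_nonneg _) (hY h' hconf))
  exact H1 M hstd g₀ (fun h' _ hconf =>
    yamabeBound_mono (min_le_left _ _) (by positivity) (Real.sqrt_nonneg _) (hY h' hconf))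

/-- The same glue concluding the decl of the second route wanting the crux,
`InformationMetricHadamard.PEFillNearRound` (identical statement text, so the two defs unfold to one proposition). -/
theorem peFillNearRoundOfPieces_proof' :
    EinsteinBulk.PEFillStandardSphere → EinsteinBulk.YamabeNearRoundSpheresStandard →
      InformationMetricHadamard.PEFillNearRound :=
  peFillNearRoundOfPieces_proof

/-! ## Exactness: the split loses nothing -/

/-- `PEFillNearRound → PEFillStandardSphere`: a manifold diffeomorphic to `S⁴` is a homotopy 4-sphere through its
diffeomorphism (crux-strategist r1). -/
theorem peFillStandardSphere_of_peFillNearRound (h : EinsteinBulk.PEFillNearRound) :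
    EinsteinBulk.PEFillStandardSphere := by
  obtain ⟨δ, hδ, H⟩ := h
  refine ⟨δ, hδ, ?_⟩
  intro M _ _ _ _ _ _ _ _ _ hstd g₀ hY
  obtain ⟨e⟩ := hstd
  exact H M e.toHomeomorph.toHomotopyEquiv g₀ hY

/-- `YamabePinchedEinsteinBulk → EinsteinHadamardFillingStandard → PEFillNearRound → YamabeNearRoundSpheresStandard`:
a PE-filled near-round class on a homotopy 4-sphere is pinched (`|K+1| ≤ 1/2`, Li–Qing–Shi, item 7996), hence
non-positively curved, and the recogniser (item 7999) returns `M ≅ S⁴` (crux-strategist r1). -/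
theorem yamabeNearRoundSpheresStandard_of_peFillNearRound (hLQS : EinsteinBulk.YamabePinchedEinsteinBulk)
    (hRec : EinsteinBulk.EinsteinHadamardFillingStandard) (h : EinsteinBulk.PEFillNearRound) :
    EinsteinBulk.YamabeNearRoundSpheresStandard := by
  obtain ⟨δ₂, hδ₂, H2⟩ := hLQS (1 / 2) (by norm_num)
  obtain ⟨δ₃, hδ₃, H3⟩ := h
  refine ⟨min δ₂ δ₃, lt_min hδ₂ hδ₃, ?_⟩
  intro M _ _ _ _ _ _ _ _ _ he g₀ hY
  obtain ⟨N, _, _, _, _, _, g, _, hRic, hpack⟩ := H3 M he g₀ (fun h' _ hconf =>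
    yamabeBound_mono (min_le_right _ _) (by positivity) (Real.sqrt_nonneg _) (hY h' hconf))
  have hpinch := H2 M g₀ N g hRic hpack (fun h' _ hconf =>
    yamabeBound_mono (min_le_left _ _) (by positivity) (Real.sqrt_nonneg _) (hY h' hconf))
  have hK : ∀ (x : N) (X Y : TangentSpace (𝓡 5) x), g.inner x X X = 1 → g.inner x Y Y = 1 →
      g.inner x X Y = 0 →
      (Literature.Geometry.Lorentzian.PseudoRiemannianMetric.ofRiemannian g).curvatureForm
        (Literature.Geometry.Lorentzian.PseudoRiemannianMetric.ofRiemannian g).leviCivita x X Y Y X ≤ 0 := by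
    intro x X Y hX1 hY1 hXY0
    have h := abs_le.mp (hpinch x X Y hX1 hY1 hXY0)
    linarith [h.2]
  exact hRec M he g₀ N g hRic hpack hK

/-- The recogniser being PROVED in the tree (`EinsteinHadamardFillingStandard_proof`), exactness needs only the
Li–Qing–Shi fact (item 7996): `YamabePinchedEinsteinBulk → PEFillNearRound → YamabeNearRoundSpheresStandard`. -/
theorem yamabeNearRoundSpheresStandard_of_peFillNearRound' (hLQS : EinsteinBulk.YamabePinchedEinsteinBulk)
    (h : EinsteinBulk.PEFillNearRound) : EinsteinBulk.YamabeNearRoundSpheresStandard :=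
  yamabeNearRoundSpheresStandard_of_peFillNearRound hLQS
    Summit.SmoothPoincare4.SmoothPoincare4.Theorems.EinsteinHadamardFillingStandard_proof h

/-! ## The SPC4 sandwich of the second piece -/

/-- `SmoothPoincare4 → YamabeNearRoundSpheresStandard`, trivially (every homotopy 4-sphere is already standard;
any `δ > 0` works and the Yamabe hypothesis is not used). -/
theorem yamabeNearRoundSpheresStandard_of_smoothPoincare4 (h : _root_.SmoothPoincare4) :
    EinsteinBulk.YamabeNearRoundSpheresStandard := by
  refine ⟨1, one_pos, ?_⟩
  intro M _ _ _ _ _ _ _ _ _ he _ _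
  exact h M inferInstance inferInstance he

/-- `YamabeNearRoundSpheresStandard → YamabeExtremalSpheres → SmoothPoincare4` by pure logic: Yamabe-extremality
(item 7998) supplies on every homotopy 4-sphere a `δ`-near-round class, which the piece recognises. (After the split
this is the SPC4 content of route `EinsteinBulk`; instance bookkeeping as in the route's `closes`.) -/
theorem smoothPoincare4_of_yamabeNearRoundSpheresStandard (hX : EinsteinBulk.YamabeNearRoundSpheresStandard)
    (hY1 : EinsteinBulk.YamabeExtremalSpheres) : _root_.SmoothPoincare4 := by
  unfold _root_.SmoothPoincare4 Literature.SPC4.SmoothPoincareConjectureFour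
    ContinuousMap.HomotopyEquiv.NonemptyDiffeomorphSphere
  intro M _ _ _ _ _ he
  show Nonempty (M ≃ₘ⟮𝓡 4, 𝓡 4⟯ Metric.sphere (0 : EuclideanSpace ℝ (Fin (4 + 1))) 1)
  haveI : CompactSpace M :=
    Literature.Topology.FourManifolds.compactSpace_of_homotopyEquiv_sphere_four_holds M he
  haveI : PathConnectedSpace (Metric.sphere (0 : EuclideanSpace ℝ (Fin 5)) 1) := by
    rw [← isPathConnected_iff_pathConnectedSpace]
    refine isPathConnected_sphere ?_ 0 zero_le_one
    rw [← Module.finrank_eq_rank, finrank_euclideanSpace_fin]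
    norm_num
  haveI : PathConnectedSpace M := by
    have e : (Metric.sphere (0 : EuclideanSpace ℝ (Fin 5)) 1) ≃ₕ M := he.symm
    have key : ∀ y : M, Joined (e.toFun (e.invFun y)) y := fun y =>
      ⟨e.right_inv.some.evalAt y⟩
    refine ⟨⟨e.toFun (Classical.arbitrary _)⟩, fun y y' => ?_⟩
    have hmid : Joined (e.toFun (e.invFun y)) (e.toFun (e.invFun y')) :=
      ⟨(PathConnectedSpace.somePath (e.invFun y) (e.invFun y')).map e.toFun.continuous⟩
    exact ((key y).symm.trans hmid).trans (key y')
  letI : MeasurableSpace M := borel M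
  haveI : BorelSpace M := ⟨rfl⟩
  obtain ⟨δ, hδ, H⟩ := hX
  obtain ⟨g₀, hY⟩ := hY1 M he δ hδ
  exact H M he g₀ hY

/-! ## The registered logical helpers of line `Sketch` (split standard-or-thin) -/

/-- **Registered helper `helper_peFillNearRound_of_halves`**: the two registered stubs of the lead's skeleton —
`stub_peFillStandard` (= item 18033 `PEFillStandardSphere`, verbatim) and `stub_exoticYamabeGap` (the uniform Yamabe
GAP for exotica, the negative form of item 18032) — imply the crux, by cases on the diffeomorphism type of `M`
(`δ := min δ₁ δ₂`; on an exotic `M` the GAP makes the Yamabe hypothesis contradictory). -/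
theorem helper_peFillNearRound_of_halves :
    (∃ δ : ℝ, 0 < δ ∧ ∀ (M : Type) [TopologicalSpace M] [T2Space M] [SecondCountableTopology M] [ChartedSpace (EuclideanSpace ℝ (Fin 4)) M] [IsManifold (𝓡 4) ∞ M] [CompactSpace M] [ConnectedSpace M] [MeasurableSpace M] [BorelSpace M], Nonempty (M ≃ₘ⟮𝓡 4, 𝓡 4⟯ Metric.sphere (0 : EuclideanSpace ℝ (Fin 5)) 1) → ∀ (g₀ : Bundle.ContMDiffRiemannianMetric (𝓡 4) ∞ (EuclideanSpace ℝ (Fin 4)) (TangentSpace (𝓡 4) : M → Type _)), (∀ (h' : Bundle.ContMDiffRiemannianMetric (𝓡 4) ∞ (EuclideanSpace ℝ (Fin 4)) (TangentSpace (𝓡 4) : M → Type _)) [(Literature.Geometry.Lorentzian.PseudoRiemannianMetric.ofRiemannian h').HasLeviCivita], (∃ φ : M → ℝ, ∀ x : M, 0 < φ x ∧ ∀ v w : TangentSpace (𝓡 4) x, h'.inner x v w = φ x * g₀.inner x v w) → (1 - δ) * (8 * Real.sqrt 6 * Real.pi) * Real.sqrt ((Literature.Geometry.Lorentzian.riemannianMeasure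 h' Set.univ).toReal) ≤ ∫ x, (Literature.Geometry.Lorentzian.PseudoRiemannianMetric.ofRiemannian h').scalarCurvature x ∂(Literature.Geometry.Lorentzian.riemannianMeasure h')) → ∃ (N : Type) (_ : TopologicalSpace N) (_ : T2Space N) (_ : SecondCountableTopology N) (_ : ChartedSpace (EuclideanSpace ℝ (Fin 5)) N) (_ : IsManifold (𝓡 5) ∞ N) (g : Bundle.ContMDiffRiemannianMetric (𝓡 5) ∞ (EuclideanSpace ℝ (Fin 5)) (TangentSpace (𝓡 5) : N → Type _)) (_ : (Literature.Geometry.Lorentzian.PseudoRiemannianMetric.ofRiemannian g).HasLeviCivita), (∀ x, (Literature.Geometry.Lorentzian.PseudoRiemannianMetric.ofRiemannian g).ricci x = (-4 : ℝ) • (Literature.Geometry.Lorentzian.PseudoRiemannianMetric.ofRiemannian g).toBilinForm x) ∧ (∃ (X : Type) (_ : TopologicalSpace X) (_ : T2Space X) (_ : SecondCountableTopology X) (_ : ChartedSpace (EuclideanHalfSpace 5) X) (_ : IsManifold (𝓡∂ 5) ∞ X) (_ : CompactSpace X) (_ : ConnectedSpace X) (j : N → X) (ι : M → X) (ρ : X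 → ℝ) (gb : Bundle.ContMDiffRiemannianMetric (𝓡∂ 5) 2 (EuclideanSpace ℝ (Fin 5)) (TangentSpace (𝓡∂ 5) : X → Type _)), Manifold.IsSmoothEmbedding (𝓡 5) (𝓡∂ 5) ∞ j ∧ Set.range j = (𝓡∂ 5).interior X ∧ Manifold.IsSmoothEmbedding (𝓡 4) (𝓡∂ 5) ∞ ι ∧ Set.range ι = (𝓡∂ 5).boundary X ∧ ContMDiff (𝓡∂ 5) 𝓘(ℝ, ℝ) ∞ ρ ∧ (∀ x : X, 0 ≤ ρ x) ∧ (∀ x : X, ρ x = 0 ↔ x ∈ (𝓡∂ 5).boundary X) ∧ (∀ y : M, ∃ ν : TangentSpace (𝓡∂ 5) (ι y), gb.inner (ι y) ν ν = 1 ∧ ∀ v : TangentSpace (𝓡∂ 5) (ι y), gb.inner (ι y) ν v = mfderiv (𝓡∂ 5) 𝓘(ℝ, ℝ) ρ (ι y) v) ∧ (∀ (x : N) (v w : TangentSpace (𝓡 5) x), gb.inner (j x) (mfderiv (𝓡 5) (𝓡∂ 5) j x v) (mfderiv (𝓡 5) (𝓡∂ 5) j x w) = ρ (j x) ^ 2 *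 g.inner x v w) ∧ (∃ φ : M → ℝ, ∀ y : M, 0 < φ y ∧ ∀ v w : TangentSpace (𝓡 4) y, gb.inner (ι y) (mfderiv (𝓡 4) (𝓡∂ 5) ι y v) (mfderiv (𝓡 4) (𝓡∂ 5) ι y w) = φ y * g₀.inner y v w))) → (∃ δ : ℝ, 0 < δ ∧ ∀ (M : Type) [TopologicalSpace M] [T2Space M] [SecondCountableTopology M] [ChartedSpace (EuclideanSpace ℝ (Fin 4)) M] [IsManifold (𝓡 4) ∞ M] [CompactSpace M] [ConnectedSpace M] [MeasurableSpace M] [BorelSpace M], M ≃ₕ Metric.sphere (0 : EuclideanSpace ℝ (Fin 5)) 1 → ¬ Nonempty (M ≃ₘ⟮𝓡 4, 𝓡 4⟯ Metric.sphere (0 : EuclideanSpace ℝ (Fin 5)) 1) → ∀ (g₀ : Bundle.ContMDiffRiemannianMetric (𝓡 4) ∞ (EuclideanSpace ℝ (Fin 4)) (TangentSpace (𝓡 4) : M → Type _)), ¬ (∀ (h' : Bundle.ContMDiffRiemannianMetric (𝓡 4) ∞ (EuclideanSpace ℝ (Fin 4)) (TangentSpace (𝓡 4) : M → Type _)) [(Literature.Geometry.Lorentzian.PseudoRiemannianMetric.ofRiemannian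 h').HasLeviCivita], (∃ φ : M → ℝ, ∀ x : M, 0 < φ x ∧ ∀ v w : TangentSpace (𝓡 4) x, h'.inner x v w = φ x * g₀.inner x v w) → (1 - δ) * (8 * Real.sqrt 6 * Real.pi) * Real.sqrt ((Literature.Geometry.Lorentzian.riemannianMeasure h' Set.univ).toReal) ≤ ∫ x, (Literature.Geometry.Lorentzian.PseudoRiemannianMetric.ofRiemannian h').scalarCurvature x ∂(Literature.Geometry.Lorentzian.riemannianMeasure h'))) → Summit.SmoothPoincare4.SmoothPoincare4.Theses.EinsteinBulk.PEFillNearRound := by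
  rintro ⟨δ₁, hδ₁, H1⟩ ⟨δ₂, hδ₂, H2⟩
  refine ⟨min δ₁ δ₂, lt_min hδ₁ hδ₂, ?_⟩
  intro M _ _ _ _ _ _ _ _ _ he g₀ hY
  by_cases hstd : Nonempty (M ≃ₘ⟮𝓡 4, 𝓡 4⟯ Metric.sphere (0 : EuclideanSpace ℝ (Fin 5)) 1)
  · exact H1 M hstd g₀ (fun h' _ hconf =>
      yamabeBound_mono (min_le_left _ _) (by positivity) (Real.sqrt_nonneg _) (hY h' hconf))
  · exfalso
    refine H2 M he hstd g₀ ?_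
    intro h' _ hconf
    exact yamabeBound_mono (min_le_right _ _) (by positivity) (Real.sqrt_nonneg _) (hY h' hconf)

/-- **Registered helper `helper_exoticYamabeGap_of_peFill`**: conversely the crux, with the Li–Qing–Shi fact (item
7996) and the proved recogniser (item 7999), implies the GAP stub — on an exotic homotopy 4-sphere a near-round class
would be filled, pinched and recognised. Hence `stub_exoticYamabeGap` is a NECESSARY piece of any proof of the crux
(modulo a published theorem), not an artefact of the case split. -/
theorem helper_exoticYamabeGap_of_peFill :
    Summit.SmoothPoincare4.SmoothPoincare4.Theses.EinsteinBulk.YamabePinchedEinsteinBulk → Summit.SmoothPoincare4.SmoothPoincare4.Theses.EinsteinBulk.PEFillNearRound → (∃ δ : ℝ, 0 < δ ∧ ∀ (M : Type) [TopologicalSpace M] [T2Space M] [SecondCountableTopology M] [ChartedSpace (EuclideanSpace ℝ (Fin 4)) M] [IsManifold (𝓡 4) ∞ M] [CompactSpace M] [ConnectedSpace M] [MeasurableSpace M] [BorelSpace M], M ≃ₕ Metric.sphere (0 : EuclideanSpace ℝ (Fin 5)) 1 → ¬ Nonempty (M ≃ₘ⟮𝓡 4, 𝓡 4⟯ Metric.sphere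 (0 : EuclideanSpace ℝ (Fin 5)) 1) → ∀ (g₀ : Bundle.ContMDiffRiemannianMetric (𝓡 4) ∞ (EuclideanSpace ℝ (Fin 4)) (TangentSpace (𝓡 4) : M → Type _)), ¬ (∀ (h' : Bundle.ContMDiffRiemannianMetric (𝓡 4) ∞ (EuclideanSpace ℝ (Fin 4)) (TangentSpace (𝓡 4) : M → Type _)) [(Literature.Geometry.Lorentzian.PseudoRiemannianMetric.ofRiemannian h').HasLeviCivita], (∃ φ : M → ℝ, ∀ x : M, 0 < φ x ∧ ∀ v w : TangentSpace (𝓡 4) x, h'.inner x v w = φ x * g₀.inner x v w) → (1 - δ) * (8 * Real.sqrt 6 * Real.pi) * Real.sqrt ((Literature.Geometry.Lorentzian.riemannianMeasure h' Set.univ).toReal) ≤ ∫ x, (Literature.Geometry.Lorentzian.PseudoRiemannianMetric.ofRiemannian h').scalarCurvature x ∂(Literature.Geometry.Lorentzian.riemannianMeasure h'))) := by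
  intro hLQS hPE
  obtain ⟨δ, hδ, H⟩ := yamabeNearRoundSpheresStandard_of_peFillNearRound' hLQS hPE
  refine ⟨δ, hδ, ?_⟩
  intro M _ _ _ _ _ _ _ _ _ he hex g₀ hY
  exact hex (H M he g₀ hY)

end Summit.SmoothPoincare4.SmoothPoincare4.Theorems.PEFillNearRoundSplit

end
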